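import Summits.AnomalousDissipation.AnomalousDissipation.Theses.TwoAndHalfD
import Literature.Barriers.AnomalousDissipation.TwoDimensionalEnergyDissipationL2Data
import Literature.Analysis.FluidPDE.ZerothLawProofs

/-!
# O4 `stub_planarEnstrophyCeiling` — the Alexakis–Doering enstrophy CEILING along one planar
# Leray–Hopf flow (line `Sketch`, crux stmt-AnomalousDissipation-0206)

Registered tool stub (section O, the witness window) of the line `Sketch` (duhamel-release) for the crux
`Summit.AnomalousDissipation.AnomalousDissipation.Theses.TwoAndHalfD.TwohalfdThesis`
(stmt-AnomalousDissipation-0206).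

Along ONE global Leray–Hopf solution `v` of the planar Navier–Stokes equations on `𝕋²` with a smooth
steady mean-zero force `g`, `‖Δg‖_∞ ≤ K` (`K ≥ 0`), viscosity `ν > 0` and `limsup`-mean energy
`⟨‖v‖₂²⟩ = meanEnergy v ≤ E`, the `limsup`-mean enstrophy obeys the CEILING
`⟨‖∇v‖₂²⟩ ≤ (K E^{3/2} / ν)^{1/2}` (Alexakis–Doering, Phys. Lett. A 359 (2006), §2, eqs. (16), (21):
`ε ≤ (ν K U³)^{1/2}` with `ε = ν⟨‖∇v‖₂²⟩`, `U³ ≤ E^{1/2} E`).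

Proof (a corollary of the landed barrier theorem).
`Literature.Barriers.AnomalousDissipation.meanDissipation_le_sqrt_of_L2` gives
`meanDissipation ν v ≤ √(ν K (√E · E))`; by definition `meanDissipation ν v = ⟨ν ‖∇v(t)‖₂²⟩` and the
nonnegative constant `ν` comes out of the `limsup` mean with no boundedness hypotheses
(`longTimeAvgSup_const_mul`), so `ν ⟨‖∇v‖₂²⟩ ≤ √(ν K (√E·E)) = ν √(K (√E·E) / ν)`
(`√(ν² y) = ν √y` for `ν ≥ 0`, `Real.sqrt_mul`, `Real.sqrt_sq`); cancel `ν > 0`.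

* `sqrt_mul_mul_eq_mul_sqrt_div` — the real-variable identity `√(ν x) = ν √(x / ν)` for `ν > 0`.
* `meanDissipation_eq_mul_longTimeAvgSup_planar` — `meanDissipation ν v = ν ⟨‖∇v‖₂²⟩` on `𝕋²`, `ν ≥ 0`.
* `stub_planarEnstrophyCeiling` — the registered statement.
Supports stmt-AnomalousDissipation-0206.

## Mathlib / Literature search

`lean search 'meanDissipation_le_sqrt_of_L2'`
(`Literature/Barriers/AnomalousDissipation/TwoDimensionalEnergyDissipationL2Data.lean:161`),
`'theorem longTimeAvgSup_const_mul'` (`Literature/Analysis/FluidPDE/ZerothLawProofs.lean:198`),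
`'theorem meanEnergy_nonneg'` (`Literature/Analysis/FluidPDE/LongTimeAverageNonneg.lean:59`, not needed:
the `ν²` factor is split off first), `'meanDissipation_eq_mul_longTimeAvgSup'` (a `𝕋³` copy lives in
`Summits/.../Theorems/BaireTransferDenseLoudLerayHopfForcesAnatomy.lean:252`, namespace
`…Theorems.DenseLoudLerayHopfForces`; the planar copy here carries the suffix `_planar`),
`'theorem (sqrt_mul|sqrt_sq|le_of_mul_le_mul_left) '` (`Mathlib/Analysis/Real/Sqrt.lean:181, :366`,
`Mathlib/Algebra/Order/GroupWithZero/Defs.lean:247`), `'stub_planarEnstrophyCeiling'` (only the skeleton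
`Cruxes/TwohalfdThesis/Lines/Sketch.lean:1039`); `lean find 'enstrophy.*sqrt|meanDissipation_le_sqrt'`
(prior stockroom): only unrelated `NsEnstrophy.sqrt_lb/ub`, nothing to adapt.
-/

noncomputable section

-- the summit path AnomalousDissipation/AnomalousDissipation duplicates a namespace component
set_option linter.dupNamespace false

namespace Summit.AnomalousDissipation.AnomalousDissipation.Theorems.TwohalfdThesis

open MeasureTheory Set Filter Topology
open scoped ENNReal NNReal
open Literature.Analysis.FunctionSpaces Literature.Analysis.FluidPDE

/-- **`√(ν x) = ν √(x / ν)` for `ν > 0`** (write `ν x = ν² (x / ν)` and take the nonnegative factor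
`ν²` out of the square root, `Real.sqrt_mul`, `Real.sqrt_sq`; no sign condition on `x`). [folklore] -/
theorem sqrt_mul_mul_eq_mul_sqrt_div {ν : ℝ} (hν : 0 < ν) (x : ℝ) :
    Real.sqrt (ν * x) = ν * Real.sqrt (x / ν) := by
  have hx : ν * x = ν ^ 2 * (x / ν) := by
    field_simp
  rw [hx, Real.sqrt_mul (sq_nonneg ν), Real.sqrt_sq hν.le]

/-- **`meanDissipation ν v = ν · ⟨‖∇v‖₂²⟩` on `𝕋²`** with the `limsup` mean of the spectral (`toReal`)
squared gradient norm, for `ν ≥ 0`: by definition `meanDissipation ν v = ⟨ν ‖∇v(t)‖₂²⟩`, and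
nonnegative constants come out of `longTimeAvgSup` with no integrability or boundedness hypotheses
(`longTimeAvgSup_const_mul`, junk values included). [folklore] -/
theorem meanDissipation_eq_mul_longTimeAvgSup_planar {ν : ℝ} (hν : 0 ≤ ν)
    (v : ℝ → UnitAddTorus (Fin 2) → EuclideanSpace ℝ (Fin 2)) :
    meanDissipation ν v = ν * longTimeAvgSup (fun t => (Torus.eGradNormSq (v t)).toReal) :=
  longTimeAvgSup_const_mul hν _

/-- **O4 `stub_planarEnstrophyCeiling` — the Alexakis–Doering enstrophy CEILING.**  Along ONE global
Leray–Hopf solution `v` of the planar Navier–Stokes equations with a smooth steady mean-zero force `g`,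
`‖Δg‖ ≤ K` (`K ≥ 0`), `ν > 0` and `⟨‖v‖₂²⟩ ≤ E`: `⟨‖∇v‖₂²⟩ ≤ (K E^{3/2} / ν)^{1/2}`.
Proof: `ν ⟨‖∇v‖₂²⟩ = meanDissipation ν v ≤ √(ν K (√E · E))`
(`meanDissipation_eq_mul_longTimeAvgSup_planar`,
`Literature.Barriers.AnomalousDissipation.meanDissipation_le_sqrt_of_L2`), and
`√(ν K (√E·E)) = ν √(K (√E·E) / ν)` (`sqrt_mul_mul_eq_mul_sqrt_div`); cancel `ν > 0`.
[cite: AlexakisDoering2006PLA, §2 eqs. (16), (21)] -/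
theorem stub_planarEnstrophyCeiling :
    ∀ (ν K E : ℝ) (g : UnitAddTorus (Fin 2) → EuclideanSpace ℝ (Fin 2))
      (v₀ : UnitAddTorus (Fin 2) → EuclideanSpace ℝ (Fin 2))
      (v : ℝ → UnitAddTorus (Fin 2) → EuclideanSpace ℝ (Fin 2)),
      0 < ν → Torus.IsSmooth g → Torus.HasZeroMean g → 0 ≤ K →
      (∀ x, ‖Torus.laplacian g x‖ ≤ K) →
      Torus.IsGlobalLerayHopf ν (fun _ => g) v₀ v → meanEnergy v ≤ E →
      longTimeAvgSup (fun t => (Torus.eGradNormSq (v t)).toReal) ≤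
        Real.sqrt (K * (Real.sqrt E * E) / ν) := by
  intro ν K E g v₀ v hν hg hg0 hK hgK hv hE
  have h := Literature.Barriers.AnomalousDissipation.meanDissipation_le_sqrt_of_L2 hν hg hg0 hK hgK hv hE
  rw [meanDissipation_eq_mul_longTimeAvgSup_planar hν.le v, mul_assoc,
    sqrt_mul_mul_eq_mul_sqrt_div hν] at h
  exact le_of_mul_le_mul_left h hν

end Summit.AnomalousDissipation.AnomalousDissipation.Theorems.TwohalfdThesis
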